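import Literature.NumberTheory.Automorphic.UnipotentTateDomain
import Mathlib.MeasureTheory.Measure.Haar.MulEquivHaarChar
import HarnessLib

/-!
# The modulus of diagonal conjugation on `N_n(𝔸_K)`, and its strict contraction on the Siegel cone

A brick of the proof of the Borel–Harish-Chandra finiteness theorem for `GL_n`
(`AdelicGroupData.exists_isAutomorphicMeasure_gl`: the automorphic quotient
`GL_n(𝔸_K) ⧸ (A_G · GL_n(K))` carries a finite invariant measure; Borel (1963), Thm. 5.8; Godement,
Sém. Bourbaki 257, §8; Getz–Hahn (2024), Thm. 2.6.2 with Exercise 3.10), which computes the Haar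
measure of a Siegel set `Ω A_{T₀}(t) K` in Iwasawa coordinates. The only non-soft input of that
computation is the behaviour of the Haar measure of the unipotent radical `N_n(𝔸_K)` under
conjugation by the torus: Godement (§8, remark after Thm. 7) uses that the modulus of `Ad(a)` on
`Lie(U_𝔸)` "is a monomial with strictly *positive* integer exponents in the simple roots". This file
provides the qualitative form of this statement that suffices for finiteness:

* `unipotentDiagConj d : N_n(𝔸_K) ≃ₜ* N_n(𝔸_K)` — conjugation `u ↦ diag(d) u diag(d)⁻¹` by a
  diagonal matrix of ideles (`adelicUnipotent n K` of `GlobalWhittakerCoefficient`/`UnipotentTateDomain`);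
* `unipotentConjChar : (𝔸_Kˣ)ⁿ →* ℝ≥0` — its modulus `χ(d)` (Mathlib `mulEquivHaarChar`), with
  `measure_image_unipotentDiagConj`: `μ(diag(d) X diag(d)⁻¹) = χ(d) μ(X)` for every Haar measure `μ`;
* `unipotentConjChar_posRealIdele_lt_one` — **strict contraction**: for a monotone family of
  positive reals `e₁ ≤ ⋯ ≤ eₙ` with a jump `e_{i₀} < e_{j₀}`, `χ(z(e)) < 1` (`z = posRealIdele`): the
  conjugation multiplies the archimedean component of the entry `uᵢⱼ` by `eᵢ/eⱼ ≤ 1`, so it maps the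
  compact identity neighbourhood `{‖(uᵢⱼ)_∞‖ ≤ 1, (uᵢⱼ)_f ∈ 𝒪̂}` into itself, missing an open subset.

Everything is proved (no named facts). `unipotentBorel` is the (local) Borel structure on `N_n(𝔸_K)`.

## References

* R. Godement, *Domaines fondamentaux des groupes arithmétiques*, Sém. Bourbaki 257 (1962/63), §8
  (English translation in Borel–Godement–Siegel–Weil (2020), PDF p. 166 of the held copy) [Godement1964].
* A. Borel, *Some finiteness properties of adele groups over number fields*, Publ. Math. IHÉS 16
  (1963), §5, Thm. 5.8 [Borel1963].
-/

noncomputable section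

open MeasureTheory Measure NumberField IsDedekindDomain Matrix Set
open scoped MatrixGroups ENNReal NNReal Pointwise

namespace Literature.NumberTheory.Automorphic

/-! ### Algebra: conjugating by diagonal matrices -/

section Algebra

variable {R : Type*} [CommRing R] {n : ℕ}

/-- Entries of `diag(d) · g · diag(d)⁻¹`: `dᵢ gᵢⱼ dⱼ⁻¹`. [folklore] -/
theorem coe_glDiagonal_mul_mul_glDiagonal_inv_apply (d : Fin n → Rˣ) (g : GL (Fin n) R)
    (i j : Fin n) :
    ((glDiagonal n R d * g * (glDiagonal n R d)⁻¹ : GL (Fin n) R) : Matrix (Fin n) (Fin n) R) i j =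
      (d i : R) * (g : Matrix (Fin n) (Fin n) R) i j * ((d j)⁻¹ : Rˣ) := by
  rw [Units.val_mul, Units.val_mul, ← map_inv, coe_glDiagonal, coe_glDiagonal, Matrix.mul_diagonal,
    Matrix.diagonal_mul, Pi.inv_apply]

/-- **Diagonal matrices normalise the upper unitriangular group**: `diag(d) u diag(d)⁻¹ ∈ N` for
`u ∈ N`. [folklore] -/
theorem glDiagonal_mul_mul_glDiagonal_inv_mem_upperUnitriangular (d : Fin n → Rˣ)
    {u : GL (Fin n) R} (hu : u ∈ upperUnitriangular (Fin n) R) :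
    glDiagonal n R d * u * (glDiagonal n R d)⁻¹ ∈ upperUnitriangular (Fin n) R := by
  rw [mem_upperUnitriangular_iff] at hu ⊢
  refine ⟨fun i j hji => ?_, fun i => ?_⟩
  · rw [coe_glDiagonal_mul_mul_glDiagonal_inv_apply, hu.1 hji, mul_zero, zero_mul]
  · rw [coe_glDiagonal_mul_mul_glDiagonal_inv_apply, hu.2 i, mul_one, Units.mul_inv]

end Algebra

/-! ### Conjugation by a diagonal adelic matrix as an automorphism of `N_n(𝔸_K)` -/

section Conj

variable {n : ℕ} {K : Type} [Field K] [NumberField K]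

/-- **Conjugation `u ↦ diag(d) u diag(d)⁻¹` by a diagonal matrix of ideles, as a topological group
automorphism of `N_n(𝔸_K)`** (`adelicUnipotent n K`). [folklore] -/
def unipotentDiagConj (d : Fin n → (AdeleRing (𝓞 K) K)ˣ) :
    ↥(adelicUnipotent n K) ≃ₜ* ↥(adelicUnipotent n K) where
  toFun u := ⟨glDiagonal n _ d * u * (glDiagonal n _ d)⁻¹,
    glDiagonal_mul_mul_glDiagonal_inv_mem_upperUnitriangular d u.2⟩
  invFun u := ⟨glDiagonal n _ d⁻¹ * u * (glDiagonal n _ d⁻¹)⁻¹,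
    glDiagonal_mul_mul_glDiagonal_inv_mem_upperUnitriangular d⁻¹ u.2⟩
  left_inv u := Subtype.ext (by simp [mul_assoc])
  right_inv u := Subtype.ext (by simp [mul_assoc])
  map_mul' u v := Subtype.ext (by simp [mul_assoc])
  continuous_toFun :=
    ((continuous_const.mul continuous_subtype_val).mul continuous_const).subtype_mk _
  continuous_invFun :=
    ((continuous_const.mul continuous_subtype_val).mul continuous_const).subtype_mk _

/-- `unipotentDiagConj d u = diag(d) u diag(d)⁻¹` in `GL_n(𝔸_K)`. [folklore] -/
@[simp]
theorem coe_unipotentDiagConj (d : Fin n → (AdeleRing (𝓞 K) K)ˣ) (u : ↥(adelicUnipotent n K)) :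
    ((unipotentDiagConj d u : ↥(adelicUnipotent n K)) : GL (Fin n) (AdeleRing (𝓞 K) K)) =
      glDiagonal n _ d * u * (glDiagonal n _ d)⁻¹ := rfl

/-- Conjugations compose: `conj(d e) = conj(d) ∘ conj(e)`. [folklore] -/
theorem unipotentDiagConj_mul (d e : Fin n → (AdeleRing (𝓞 K) K)ˣ) :
    unipotentDiagConj (d * e) = (unipotentDiagConj e).trans (unipotentDiagConj d) := by
  ext u : 2
  change glDiagonal n _ (d * e) * u * (glDiagonal n _ (d * e))⁻¹ =
    glDiagonal n _ d * (glDiagonal n _ e * u * (glDiagonal n _ e)⁻¹) * (glDiagonal n _ d)⁻¹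
  rw [map_mul, _root_.mul_inv_rev]
  simp only [mul_assoc]

/-- `conj(1) = id`. [folklore] -/
theorem unipotentDiagConj_one :
    unipotentDiagConj (1 : Fin n → (AdeleRing (𝓞 K) K)ˣ) = ContinuousMulEquiv.refl _ := by
  ext u : 2
  change glDiagonal n (AdeleRing (𝓞 K) K) 1 * (u : GL (Fin n) (AdeleRing (𝓞 K) K)) *
    (glDiagonal n (AdeleRing (𝓞 K) K) 1)⁻¹ = u
  rw [map_one, inv_one, one_mul, mul_one]

end Conj

/-! ### The modulus `χ(d)` -/

section HaarChar

variable (n : ℕ) (K : Type) [Field K] [NumberField K]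

/-- The Borel σ-algebra on `N_n(𝔸_K)` (a *local* instance, as for `adelicBorel` on `GL_n(𝔸_K)`).
[folklore] -/
@[reducible] def unipotentBorel : MeasurableSpace ↥(adelicUnipotent n K) := borel _

attribute [local instance] unipotentBorel

/-- `N_n(𝔸_K)` with `unipotentBorel` is a Borel space (by definition). [folklore] -/
theorem borelSpace_unipotent : BorelSpace ↥(adelicUnipotent n K) := ⟨rfl⟩

attribute [local instance] borelSpace_unipotent

variable {n K}

/-- **The modulus `χ(d) > 0` of the conjugation `u ↦ diag(d) u diag(d)⁻¹` on `N_n(𝔸_K)`**: the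
factor by which this automorphism multiplies Haar measure (Mathlib `mulEquivHaarChar`), as a
monoid homomorphism `(𝔸_Kˣ)ⁿ →* ℝ≥0` (multiplicativity: `mulEquivHaarChar_trans`). [folklore] -/
def unipotentConjChar : (Fin n → (AdeleRing (𝓞 K) K)ˣ) →* ℝ≥0 where
  toFun d := mulEquivHaarChar (unipotentDiagConj d)
  map_one' := by rw [unipotentDiagConj_one, mulEquivHaarChar_refl]
  map_mul' d e := by rw [unipotentDiagConj_mul, mulEquivHaarChar_trans, mul_comm]

/-- Unfolding: `χ(d) = mulEquivHaarChar (conj d)`. [folklore] -/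
theorem unipotentConjChar_apply (d : Fin n → (AdeleRing (𝓞 K) K)ˣ) :
    unipotentConjChar d = mulEquivHaarChar (unipotentDiagConj d) := rfl

/-- `0 < χ(d)`. [folklore] -/
theorem unipotentConjChar_pos (d : Fin n → (AdeleRing (𝓞 K) K)ˣ) : 0 < unipotentConjChar d :=
  mulEquivHaarChar_pos _

/-- Haar measures on `N_n(𝔸_K)` are regular (second countable locally compact group). [folklore] -/
theorem regular_of_isHaarMeasure_adelicUnipotent (μ : Measure ↥(adelicUnipotent n K))
    [IsHaarMeasure μ] : μ.Regular := by
  infer_instance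

/-- **`χ(d)` is the factor by which `conj(d)` scales Haar measure**:
`μ(diag(d) X diag(d)⁻¹) = χ(d) · μ(X)` for every Haar measure `μ` on `N_n(𝔸_K)` and every set `X`.
[folklore] -/
theorem measure_image_unipotentDiagConj (μ : Measure ↥(adelicUnipotent n K)) [IsHaarMeasure μ]
    (d : Fin n → (AdeleRing (𝓞 K) K)ˣ) (X : Set ↥(adelicUnipotent n K)) :
    μ (unipotentDiagConj d '' X) = unipotentConjChar d * μ X := by
  haveI := regular_of_isHaarMeasure_adelicUnipotent μ
  have h := mulEquivHaarChar_smul_preimage μ (X := unipotentDiagConj d '' X) (unipotentDiagConj d)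
  rw [Set.preimage_image_eq X (unipotentDiagConj d).injective] at h
  rw [← h, unipotentConjChar_apply, ENNReal.smul_def, smul_eq_mul]

end HaarChar

/-! ### Conjugation by positive real diagonal matrices: entries, and strict contraction -/

section Contraction

open scoped Classical

variable {n : ℕ} {K : Type} [Field K] [NumberField K]

attribute [local instance] unipotentBorel borelSpace_unipotent

/-- Entries of `diag(z(e)) u diag(z(e))⁻¹` for positive real `e = (e₁, …, eₙ)` (`z = posRealIdele`):
the `(i, j)` entry is `(eᵢ/eⱼ, 1) · uᵢⱼ`, the real scalar `eᵢ/eⱼ` acting on the archimedean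
component only (`realAdele`). [folklore] -/
theorem coe_unipotentDiagConj_posRealIdele_apply (e : Fin n → ℝ≥0ˣ) (u : ↥(adelicUnipotent n K))
    (i j : Fin n) :
    (((unipotentDiagConj (fun k => posRealIdele K (e k)) u : ↥(adelicUnipotent n K)) :
        GL (Fin n) (AdeleRing (𝓞 K) K)) : Matrix (Fin n) (Fin n) (AdeleRing (𝓞 K) K)) i j =
      realAdele K (((e i * (e j)⁻¹ : ℝ≥0ˣ) : ℝ≥0) : ℝ) *
        ((u : GL (Fin n) (AdeleRing (𝓞 K) K)) : Matrix (Fin n) (Fin n) (AdeleRing (𝓞 K) K)) i j := by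
  rw [coe_unipotentDiagConj, coe_glDiagonal_mul_mul_glDiagonal_inv_apply, mul_right_comm,
    ← Units.val_mul, ← map_inv, ← map_mul, coe_posRealIdele]

/-- The archimedean component of `(ρ, 1) · x` is `ρ · x_∞` and its image in `ℝ^{r₁} × ℂ^{r₂}` is
`ρ • (x_∞)` (the real structure of `K_∞` is transported from the mixed space). [folklore] -/
theorem ringEquiv_mixedSpace_fst_realAdele_mul (ρ : ℝ) (x : AdeleRing (𝓞 K) K) :
    InfiniteAdeleRing.ringEquiv_mixedSpace K (realAdele K ρ * x).1 =
      ρ • InfiniteAdeleRing.ringEquiv_mixedSpace K x.1 := by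
  have h1 : (realAdele K ρ * x).1 = realToInfiniteAdele K ρ * x.1 := rfl
  rw [h1, map_mul]
  change InfiniteAdeleRing.ringEquiv_mixedSpace K ((InfiniteAdeleRing.ringEquiv_mixedSpace K).symm
    (algebraMap ℝ (mixedEmbedding.mixedSpace K) ρ)) * _ = _
  rw [RingEquiv.apply_symm_apply, Algebra.smul_def]

/-- The finite component of `(ρ, 1) · x` is that of `x`. [folklore] -/
theorem snd_realAdele_mul (ρ : ℝ) (x : AdeleRing (𝓞 K) K) : (realAdele K ρ * x).2 = x.2 := by
  have h1 : (realAdele K ρ * x).2 = (realAdele K ρ).2 * x.2 := rfl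
  rw [h1, realAdele_snd, one_mul]

/-- **Strict contraction.** Let `e = (e₁ ≤ e₂ ≤ ⋯ ≤ eₙ)` be a monotone family of positive reals
with a strict inequality `e_{i₀} < e_{j₀}` for some `i₀ < j₀`. Then conjugation by the positive
real diagonal matrix `diag(z(e₁), …, z(eₙ))` **strictly decreases Haar measure on `N_n(𝔸_K)`**:
`χ(z(e)) < 1`. Indeed it multiplies the archimedean component of the `(i, j)` entry by
`eᵢ/eⱼ ≤ 1`, so it maps the compact identity neighbourhood
`U₀ = {u : ‖(uᵢⱼ)_∞‖ ≤ 1, (uᵢⱼ)_f ∈ 𝒪̂_K}` into itself, missing the open subset of `U₀` where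
`e_{i₀}/e_{j₀} < ‖(u_{i₀j₀})_∞‖ < 1`; hence `χ · μ(U₀) = μ(conj U₀) < μ(U₀)`. (This is the
qualitative content of the classical computation of the modulus of `Ad(a)` on `Lie(N_𝔸)` as a
monomial in the simple roots: Godement, Sém. Bourbaki 257, §8, remark after Thm. 7.) [folklore] -/
theorem unipotentConjChar_posRealIdele_lt_one {e : Fin n → ℝ≥0ˣ}
    (hmono : ∀ i j : Fin n, i ≤ j → (e i : ℝ≥0) ≤ e j) {i₀ j₀ : Fin n} (hlt : i₀ < j₀)
    (hjump : (e i₀ : ℝ≥0) < e j₀) :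
    unipotentConjChar (fun k => posRealIdele K (e k)) < 1 := by
  haveI := t2Space_adeleRing K
  -- notation
  set φ := InfiniteAdeleRing.ringEquiv_mixedSpace K with hφ
  set conj := unipotentDiagConj (n := n) (fun k => posRealIdele K (e k)) with hconj
  set ent : Fin n → Fin n → ↥(adelicUnipotent n K) → AdeleRing (𝓞 K) K := fun i j u =>
    ((u : GL (Fin n) (AdeleRing (𝓞 K) K)) : Matrix (Fin n) (Fin n) (AdeleRing (𝓞 K) K)) i j
    with hent
  have hent_cont : ∀ i j, Continuous (ent i j) := fun i j => continuous_adelicUnipotent_apply i j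
  -- the ratios `eᵢ/eⱼ ≤ 1` for `i ≤ j`, `< 1` at `(i₀, j₀)`
  set ρ : Fin n → Fin n → ℝ := fun i j => (((e i * (e j)⁻¹ : ℝ≥0ˣ) : ℝ≥0) : ℝ) with hρ
  have hρ_eq : ∀ i j, ρ i j = ((e i : ℝ≥0) : ℝ) / ((e j : ℝ≥0) : ℝ) := fun i j => by
    simp only [hρ, Units.val_mul, Units.val_inv_eq_inv_val, NNReal.coe_mul, NNReal.coe_inv,
      div_eq_mul_inv]
  have hρ_nonneg : ∀ i j, 0 ≤ ρ i j := fun i j => NNReal.coe_nonneg _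
  have hepos : ∀ i, (0 : ℝ) < ((e i : ℝ≥0) : ℝ) := fun i =>
    NNReal.coe_pos.2 (pos_iff_ne_zero.2 (e i).ne_zero)
  have hρ_le : ∀ i j, i ≤ j → ρ i j ≤ 1 := fun i j hij => by
    rw [hρ_eq, div_le_one (hepos j)]
    exact_mod_cast hmono i j hij
  have hρ₀ : ρ i₀ j₀ < 1 := by
    rw [hρ_eq, div_lt_one (hepos j₀)]
    exact_mod_cast hjump
  -- the entries of `conj u`
  have hent_conj : ∀ u i j, ent i j (conj u) = realAdele K (ρ i j) * ent i j u := fun u i j =>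
    coe_unipotentDiagConj_posRealIdele_apply e u i j
  have hnorm_conj : ∀ u i j, ‖φ (ent i j (conj u)).1‖ = ρ i j * ‖φ (ent i j u).1‖ := by
    intro u i j
    rw [hent_conj, ringEquiv_mixedSpace_fst_realAdele_mul, norm_smul, Real.norm_eq_abs,
      abs_of_nonneg (hρ_nonneg i j)]
  have hsnd_conj : ∀ u i j, (ent i j (conj u)).2 = (ent i j u).2 := fun u i j => by
    rw [hent_conj, snd_realAdele_mul]
  -- the box `C = C_∞ × 𝒪̂` and its open core
  set C : Set (AdeleRing (𝓞 K) K) :=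
    {x | ‖φ x.1‖ ≤ 1 ∧ x.2 ∈ (integralFiniteAdeles K : Set (FiniteAdeleRing (𝓞 K) K))} with hC
  set Ci : Set (AdeleRing (𝓞 K) K) :=
    {x | ‖φ x.1‖ < 1 ∧ x.2 ∈ (integralFiniteAdeles K : Set (FiniteAdeleRing (𝓞 K) K))} with hCi
  have hCiC : Ci ⊆ C := fun x hx => ⟨hx.1.le, hx.2⟩
  have h0Ci : (0 : AdeleRing (𝓞 K) K) ∈ Ci :=
    ⟨by change ‖φ 0‖ < 1; rw [map_zero, norm_zero]; exact one_pos,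
      (integralFiniteAdeles K).zero_mem⟩
  have hφc : Continuous fun x : AdeleRing (𝓞 K) K => φ x.1 :=
    (continuous_ringEquiv_mixedSpace K).comp continuous_fst
  have hCi_open : IsOpen Ci :=
    (isOpen_lt (continuous_norm.comp hφc) continuous_const).inter
      ((isOpen_integralFiniteAdeles K).preimage continuous_snd)
  have hC_cpt : IsCompact C := by
    have h1 : IsCompact (φ ⁻¹' Metric.closedBall (0 : mixedEmbedding.mixedSpace K) 1) := by
      have : φ ⁻¹' Metric.closedBall (0 : mixedEmbedding.mixedSpace K) 1 =
          φ.symm '' Metric.closedBall 0 1 := by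
        ext z
        constructor
        · intro hz; exact ⟨φ z, hz, φ.symm_apply_apply z⟩
        · rintro ⟨w, hw, rfl⟩
          rw [Set.mem_preimage, RingEquiv.apply_symm_apply]
          exact hw
      rw [this]
      exact (isCompact_closedBall _ _).image (continuous_ringEquiv_mixedSpace_symm K)
    have hC' : C = (φ ⁻¹' Metric.closedBall 0 1) ×ˢ
        (integralFiniteAdeles K : Set (FiniteAdeleRing (𝓞 K) K)) := by
      ext x
      change (‖φ x.1‖ ≤ 1 ∧ x.2 ∈ (integralFiniteAdeles K : Set (FiniteAdeleRing (𝓞 K) K))) ↔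
        (x.1 ∈ φ ⁻¹' Metric.closedBall (0 : mixedEmbedding.mixedSpace K) 1 ∧
          x.2 ∈ (integralFiniteAdeles K : Set (FiniteAdeleRing (𝓞 K) K)))
      rw [Set.mem_preimage, mem_closedBall_zero_iff]
    rw [hC']
    exact h1.prod (isCompact_integralFiniteAdeles K)
  have hC_closed : IsClosed C := hC_cpt.isClosed
  -- `U₀` and `V`
  set U₀ : Set ↥(adelicUnipotent n K) := {u | ∀ i j : Fin n, i < j → ent i j u ∈ C} with hU₀
  set V : Set ↥(adelicUnipotent n K) := {u | ∀ i j : Fin n, i < j → ent i j u ∈ Ci} with hV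
  have hVU : V ⊆ U₀ := fun u hu i j hij => hCiC (hu i j hij)
  have hV_open : IsOpen V := by
    have : V = ⋂ i : Fin n, ⋂ j : Fin n, ⋂ (_ : i < j), ent i j ⁻¹' Ci := by
      ext u; simp only [hV, Set.mem_setOf_eq, Set.mem_iInter, Set.mem_preimage]
    rw [this]
    exact isOpen_iInter_of_finite fun i => isOpen_iInter_of_finite fun j =>
      isOpen_iInter_of_finite fun _ => hCi_open.preimage (hent_cont i j)
  have hU₀_closed : IsClosed U₀ := by
    have : U₀ = ⋂ i : Fin n, ⋂ j : Fin n, ⋂ (_ : i < j), ent i j ⁻¹' C := by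
      ext u; simp only [hU₀, Set.mem_setOf_eq, Set.mem_iInter, Set.mem_preimage]
    rw [this]
    exact isClosed_iInter fun i => isClosed_iInter fun j => isClosed_iInter fun _ =>
      hC_closed.preimage (hent_cont i j)
  have hU₀_cpt : IsCompact U₀ := by
    set box : Set (Fin n → Fin n → AdeleRing (𝓞 K) K) := univ.pi fun _ => univ.pi fun _ => C
      with hbox
    have hboxc : IsCompact box := isCompact_univ_pi fun _ => isCompact_univ_pi fun _ => hC_cpt
    refine (hboxc.image continuous_unitriangularOfAdeles).of_isClosed_subset hU₀_closed ?_
    intro u hu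
    refine ⟨_, ?_, unitriangularOfAdeles_eq u⟩
    refine mem_univ_pi.2 fun i => mem_univ_pi.2 fun j => ?_
    by_cases hij : i < j
    · simp only [if_pos hij]; exact hu i j hij
    · simp only [if_neg hij]; exact hCiC h0Ci
  -- `conj U₀ ⊆ U₀`
  have hconj_mem : ∀ u ∈ U₀, conj u ∈ U₀ := by
    intro u hu i j hij
    refine ⟨?_, ?_⟩
    · rw [hnorm_conj]
      exact (mul_le_mul (hρ_le i j hij.le) (hu i j hij).1 (norm_nonneg _) zero_le_one).trans_eq
        (one_mul 1)
    · rw [hsnd_conj]; exact (hu i j hij).2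
  -- a point of `V` missed by `conj U₀`
  obtain ⟨y₁, hy₁⟩ := exists_ne (0 : mixedEmbedding.mixedSpace K)
  set r : ℝ := (1 + ρ i₀ j₀) / 2 with hr
  have hr_pos : 0 < r := by rw [hr]; linarith [hρ_nonneg i₀ j₀]
  have hr_lt : r < 1 := by rw [hr]; linarith
  have hρr : ρ i₀ j₀ < r := by rw [hr]; linarith
  set y : mixedEmbedding.mixedSpace K := (r / ‖y₁‖) • y₁ with hy
  have hy_norm : ‖y‖ = r := by
    rw [hy, norm_smul, Real.norm_eq_abs, abs_of_nonneg (div_nonneg hr_pos.le (norm_nonneg _)),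
      div_mul_cancel₀ _ (norm_ne_zero_iff.2 hy₁)]
  set a : AdeleRing (𝓞 K) K := (φ.symm y, 0) with ha
  have hφa : φ a.1 = y := by rw [ha]; exact RingEquiv.apply_symm_apply φ y
  set p : ↥(adelicUnipotent n K) :=
    unitriangularOfAdeles fun i j => if i = i₀ ∧ j = j₀ then a else 0 with hp
  have hp_ent : ∀ i j, i < j → ent i j p = if i = i₀ ∧ j = j₀ then a else 0 := by
    intro i j hij
    change ((unitriangularGL _ : GL (Fin n) (AdeleRing (𝓞 K) K)) :
      Matrix (Fin n) (Fin n) (AdeleRing (𝓞 K) K)) i j = _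
    rw [coe_unitriangularGL, unitriangularOfEntries_apply, if_neg (ne_of_lt hij), if_pos hij]
  have hpV : p ∈ V := by
    intro i j hij
    rw [hp_ent i j hij]
    by_cases h : i = i₀ ∧ j = j₀
    · rw [if_pos h]
      exact ⟨by rw [hφa, hy_norm]; exact hr_lt, by rw [ha]; exact (integralFiniteAdeles K).zero_mem⟩
    · rw [if_neg h]; exact h0Ci
  have hp_not : p ∉ conj '' U₀ := by
    rintro ⟨u, hu, hpu⟩
    have h1 : ‖φ (ent i₀ j₀ (conj u)).1‖ ≤ ρ i₀ j₀ := by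
      rw [hnorm_conj]
      exact (mul_le_mul_of_nonneg_left (hu i₀ j₀ hlt).1 (hρ_nonneg _ _)).trans_eq (mul_one _)
    rw [hpu, hp_ent i₀ j₀ hlt, if_pos ⟨rfl, rfl⟩, hφa, hy_norm] at h1
    exact absurd h1 (not_le.2 hρr)
  -- measure comparison
  set μ : Measure ↥(adelicUnipotent n K) := haar with hμ
  have hconj_sub : conj '' U₀ ⊆ U₀ := by
    rintro _ ⟨u, hu, rfl⟩; exact hconj_mem u hu
  have hW_open : IsOpen (V \ conj '' U₀) :=
    hV_open.sdiff (hU₀_cpt.image conj.continuous).isClosed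
  have hW_pos : 0 < μ (V \ conj '' U₀) :=
    hW_open.measure_pos μ ⟨p, hpV, hp_not⟩
  have hU₀_top : μ U₀ < ⊤ := hU₀_cpt.measure_lt_top
  have hsum : μ (conj '' U₀) + μ (V \ conj '' U₀) ≤ μ U₀ := by
    rw [← measure_union disjoint_sdiff_right hW_open.measurableSet]
    exact measure_mono (union_subset hconj_sub fun u hu => hVU hu.1)
  have hlt' : μ (conj '' U₀) < μ U₀ := by
    refine lt_of_lt_of_le ?_ hsum
    exact ENNReal.lt_add_right ((measure_mono hconj_sub).trans_lt hU₀_top).ne hW_pos.ne'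
  rw [measure_image_unipotentDiagConj μ] at hlt'
  have hχ : (unipotentConjChar (fun k => posRealIdele K (e k)) : ℝ≥0∞) < 1 := by
    by_contra hge
    rw [not_lt] at hge
    exact absurd hlt' (not_lt.2 (le_mul_of_one_le_left bot_le hge))
  exact_mod_cast hχ

end Contraction

end Literature.NumberTheory.Automorphic
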